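import Literature.NumberTheory.Transcendental.PkappaThetaHilbert
import Mathlib.Combinatorics.Nullstellensatz
import Mathlib.Algebra.Order.Antidiag.FinsuppEquiv
import Mathlib.Analysis.Normed.Module.Connected
import Mathlib.LinearAlgebra.Complex.FiniteDimensional
import Mathlib.LinearAlgebra.Dual.Lemmas
import Mathlib.Topology.Compactness.Lindelof
import HarnessLib

/-!
# Lower bound for the Hilbert function of cosets of algebraic subgroups of `M_κ` (theta model)

Topic: `Literature/NumberTheory/Transcendental`. A brick towards the discharge of the named fact
`philippon1986_std` (`PhilipponZeroEstimateStd.lean`: Philippon 1986, Thm. 2.1, for the group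
varieties `M_κ = 𝔾ₘ^β × P_κ` in the theta embedding of `PkappaTheta.lean`), complementing
`PkappaThetaHilbert.lean` (the upper bound `H(M_κ; D) ≤ 6ⁿDⁿ` for the right-hand side of the
zero estimate). The LEFT-hand side of D. Roy's form of the estimate (Nesterenko–Philippon (eds.),
LNM 1752, Ch. 11, Thm. 4.1 with Prop. 2.3) carries the factor `ℋ(H₀; D) = deg(H₀)·D^{dim H₀}`
for the obstruction subgroup `H₀` and its translates `σ + H₀`, `σ ∈ Σ`, and the final count only
uses `ℋ(H₀; D) ≥ D^{dim H₀}` (op. cit. p. 221: "`ℋ(H₀; D) ≥ D^{n-δ}`"); in a proof that works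
with Hilbert FUNCTIONS at finite degrees rather than with Hilbert polynomials (as the tree's
discharge of the `𝔾ₐ × 𝔾ₘⁿ` case does, `PhilipponZeroEstimateHolds.lean` with
`GaGmSubgroupDegrees.lean`) this is the statement that the ideal `𝔭 = 𝔍(σ + H₀)` of a translate
of a connected algebraic subgroup has `H(𝔭; t) ≥ c·t^{dim H₀}` with `c > 0` independent of `H₀`.

Here we PROVE that lower bound for the theta model of `M_κ`, for the connected algebraic
subgroups `G'` of `M_κ,ℂ` as classified in the leaf (`GaGmE.Std.SubgroupDataC`, Lie algebra
`K.tangent`) and for ALL translates `w₀ + Lie G'`, uniformly: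

* `exists_linearIndependent_thetaEval_coset` — for `K : SubgroupDataC`, `w₀ ∈ Lie M_κ,ℂ`, `t : ℕ`
  and `m = dim_ℂ K.tangent` there are `binom(t + m, m)` forms `P_k` of degree `t` in the theta
  coordinates `X_J` whose pull-backs `w ↦ F_{P_k}(w₀ + w) = P_k(Θ(w₀ + w))` to `Lie G'` are
  `ℂ`-linearly independent;
* `choose_le_finrank_cosetSpace` — hence `dim_ℂ (ℂ[X]_t|_{w₀ + Lie G'}) ≥ binom(t + m, m)`
  (`≥ t^m/m!`), i.e. `H(𝔍(exp(w₀) + G'); t) ≥ binom(t + m, m)` (`GaGmE.Std.cosetSpace`);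
* `choose_le_finrank_thetaSpace` — the case `G' = M_κ`: `H(M_κ; t) ≥ binom(t + n, n)`,
  `n = dim M_κ`, the lower bound matching `GaGmE.Std.finrank_thetaSpace_le`.

## Proof

`Lie G' = T_Y × T_Z × T_S` is cut out blockwise (`SubgroupDataC.tangentEquiv`); choose free
coordinates `F_y ⊆ β`, `F_z ⊆ γ`, `F_s ⊆ δ` of the three blocks
(`Submodule.exists_finset_restrict_bijective`: a basis of `V^*` among the coordinate functionals),
`|F_y| + |F_z| + |F_s| = m`. On the coset, an `E`-coordinate `z'_b` that is constant with a
lattice value is *degenerate* (`GaGmE.Std.degenerate`); the chart `J* = (none, (M*, none))` with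
`M* b = 2` on the degenerate coordinates and `0` elsewhere has `Θ_{J*} ≠ 0` at the *good* points
of the coset (degenerate coordinates in `Λ`, the others off `Λ`; `P₂ ≠ 0` over `Λ`,
`P₀ = σ³ ≠ 0` off `Λ`). The `m` coordinate functions `Θ_{J(i)}/Θ_{J*}` (`GaGmE.Std.vals`) are
`e^{y'_j}` (`j ∈ F_y`), `℘(z'_b)` (`b ∈ F_z`) and `s_e - ∑_b κ_{eb} Z_{M* b}(z'_b)/P_{M* b}(z'_b)`
(`e ∈ F_s`) at good points, and for `|μ| ≤ t` the theta monomial `X^{expo μ}` of degree `t`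
(`∏ X_{J(i)}^{μ_i} · X_{J*}^{t-|μ|}`) evaluates to `Θ_{J*}^t · vals^μ`
(`thetaEval_monomial_expo`). A linear relation among the pull-backs of these monomials is thus a
polynomial `R` of partial degrees `≤ t` in `m` variables vanishing at `vals(w')` for all good
`w'` in the coset; since every point of a grid `∏ A_i`, `#A_i = t + 1`, is such a value vector
(`exists_good_vals_eq`: prescribe `e^{y'_j}` by logarithms, `℘(z'_b)` on a grid of values of the
free `E`-coordinates chosen so that all non-constant `E`-coordinates of the coset stay off the
lattice — `exists_grid_avoiding`, countable avoidance using that `Λ` and the fibres of `℘` are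
countable, `countable_fibre_weierstrassP` — and then the fibre coordinates, which are the free
`s_e` plus a function of `z'`), `R = 0` by the Combinatorial Nullstellensatz
(`MvPolynomial.eq_zero_of_eval_zero_at_prod_finset`). The count is stars and bars (`degLE`,
`card_degLE`).

Only real definitions (block subspaces, the chart, coordinate functions, value grids, the
restriction map `cosetRes` and the space `cosetSpace`); no named facts.

## References

* Yu. V. Nesterenko, P. Philippon (eds.), *Introduction to Algebraic Independence Theory*,
  LNM 1752, Springer 2001, Ch. 11 (D. Roy): §2.2 (Hilbert function `H(I; D)`, `ℋ`), Prop. 2.3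
  (`ℋ(Σ + H; cD) ≥ card((Σ + H₀)/H₀) ℋ(H₀; D)`), Thm. 4.1 and Cor. 4.2 (p. 221:
  `ℋ(H₀; D) ≥ D^{n-δ}`).
* P. Philippon, *Lemmes de zéros dans les groupes algébriques commutatifs*, Bull. Soc. Math.
  France 114 (1986), 355–383, Thm. 2.1 (`H(G'; D₁, …, D_p)`), §3.
* N. Alon, *Combinatorial Nullstellensatz*, Combin. Probab. Comput. 8 (1999), 7–29, Thm. 1.2
  (Mathlib `MvPolynomial.eq_zero_of_eval_zero_at_prod_finset`).
-/

noncomputable section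

open Complex MvPolynomial Module Filter Topology
open scoped PeriodPair

namespace Literature.NumberTheory.Transcendental

namespace GaGmE

namespace Std

/-! ### Generic lemma: free coordinates of a subspace of `K^ι` -/

/-- **Free coordinates.** A subspace `V ≤ K^ι` (`ι` finite) has a set `F` of `dim V` coordinates
such that `v ↦ (v_i)_{i ∈ F}` is a linear isomorphism `V ≅ K^F` (the non-pivot columns of a
reduced echelon form; here: a basis of `V^*` extracted from the coordinate functionals).
[folklore] -/
theorem _root_.Submodule.exists_finset_restrict_bijective {K ι : Type*} [Field K] [Fintype ι]
    (V : Submodule K (ι → K)) :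
    ∃ F : Finset ι, F.card = finrank K V ∧
      Function.Bijective (fun v : V => fun i : F => (v : ι → K) i) := by
  classical
  let c : ι → Dual K V := fun i => (LinearMap.proj i).comp V.subtype
  have hc : ∀ i (v : V), c i v = (v : ι → K) i := fun i v => rfl
  -- the coordinate functionals span the dual space of `V`
  have hco : (Submodule.span K (Set.range c)).dualCoannihilator = ⊥ := by
    rw [eq_bot_iff]
    intro v hv
    rw [Submodule.mem_dualCoannihilator] at hv
    rw [Submodule.mem_bot]
    apply Subtype.ext
    funext i
    have := hv (c i) (Submodule.subset_span ⟨i, rfl⟩)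
    simpa [hc] using this
  have hspan : Submodule.span K (Set.range c) = ⊤ := by
    apply Submodule.eq_top_of_finrank_eq
    have h := Subspace.finrank_add_finrank_dualCoannihilator_eq (Submodule.span K (Set.range c))
    rw [hco, finrank_bot, add_zero] at h
    rw [h, Subspace.dual_finrank_eq]
  obtain ⟨κ, a, ha, hsp, hli⟩ := exists_linearIndependent' K c
  rw [hspan] at hsp
  haveI : Finite κ := Finite.of_injective a ha
  haveI : Fintype κ := Fintype.ofFinite κ
  let F : Finset ι := Finset.univ.image a
  have hFcard : F.card = Fintype.card κ := Finset.card_image_of_injective _ ha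
  have hκ : Fintype.card κ = finrank K V := by
    have h1 : finrank K (Submodule.span K (Set.range (c ∘ a))) = Fintype.card κ :=
      finrank_span_eq_card hli
    rw [hsp, finrank_top, Subspace.dual_finrank_eq] at h1
    exact h1.symm
  refine ⟨F, hFcard.trans hκ, ?_⟩
  let f : V →ₗ[K] (F → K) := LinearMap.pi fun i : F => c i
  have hf_inj : Function.Injective f := by
    rw [← LinearMap.ker_eq_bot, LinearMap.ker_eq_bot']
    intro v hv
    rw [← Module.forall_dual_apply_eq_zero_iff K v]
    intro φ
    have hφ : φ ∈ Submodule.span K (Set.range (c ∘ a)) := by rw [hsp]; trivial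
    induction hφ using Submodule.span_induction with
    | mem x hx =>
      obtain ⟨k, rfl⟩ := hx
      have : f v ⟨a k, Finset.mem_image_of_mem a (Finset.mem_univ k)⟩ = 0 := by rw [hv]; rfl
      simpa [f] using this
    | zero => simp
    | add x y _ _ hx hy => simp [hx, hy]
    | smul r x _ hx => simp [hx]
  have hfin : finrank K V = finrank K (F → K) := by
    rw [Module.finrank_fintype_fun_eq_card, Fintype.card_coe, hFcard, hκ]
  have hf_surj : Function.Surjective f :=
    (LinearMap.injective_iff_surjective_of_finrank_eq_finrank hfin).mp hf_inj
  exact ⟨hf_inj, hf_surj⟩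

/-! ### Generic lemma: the fibres of `℘` are countable -/

/-- **The fibres of `℘` off the lattice are countable** (principle of isolated zeros on the
connected open set `ℂ ∖ Λ`, where `℘` is not constant since it has a double pole at `0`; discrete
subsets of `ℂ` are countable). [folklore] -/
theorem countable_fibre_weierstrassP (L : PeriodPair) (a : ℂ) :
    {z | z ∉ L.lattice ∧ ℘[L] z = a}.Countable := by
  have hconn : IsConnected ((L.lattice : Set ℂ)ᶜ) :=
    (countable_lattice L).isConnected_compl_of_one_lt_rank (by rw [rank_real_complex]; norm_num)
  -- `℘` is not constantly `a` off the lattice: it has a pole at `0`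
  have hex : ∃ x, x ∉ L.lattice ∧ ℘[L] x ≠ a := by
    by_contra h
    push Not at h
    have hev : ℘[L] =ᶠ[𝓝[≠] (0 : ℂ)] fun _ => a := by
      have hn : ((L.lattice : Set ℂ) \ {0})ᶜ ∈ 𝓝 (0 : ℂ) := L.compl_lattice_sdiff_singleton_mem_nhds 0
      filter_upwards [mem_nhdsWithin_of_mem_nhds hn, self_mem_nhdsWithin] with z hz hz0
      refine h z fun hzΛ => hz ⟨hzΛ, ?_⟩
      simpa using hz0
    have h1 := meromorphicOrderAt_congr hev
    classical
    rw [L.order_weierstrassP 0 (zero_mem _), meromorphicOrderAt_const] at h1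
    split_ifs at h1 <;> simp at h1
  obtain ⟨x, hx, hxa⟩ := hex
  have hψ : AnalyticOnNhd ℂ (fun z => ℘[L] z - a) (L.lattice : Set ℂ)ᶜ := fun z hz =>
    (L.analyticOnNhd_weierstrassP z hz).sub analyticAt_const
  have hcod := hψ.preimage_zero_mem_codiscreteWithin (x := x) (sub_ne_zero.mpr hxa) hx hconn
  have hdisc : IsDiscrete ((fun z => ℘[L] z - a) ⁻¹' {0} ∩ (L.lattice : Set ℂ)ᶜ) :=
    isDiscrete_of_codiscreteWithin (by simpa using hcod)
  have heq : {z | z ∉ L.lattice ∧ ℘[L] z = a} = (fun z => ℘[L] z - a) ⁻¹' {0} ∩ (L.lattice : Set ℂ)ᶜ := by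
    ext z
    simp [sub_eq_zero, and_comm]
  rw [heq]
  exact (HereditarilyLindelofSpace.isLindelof _).countable_of_isDiscrete hdisc

/-! ### Generic lemma: large finite sets avoiding a countable set, on which a function is injective -/

/-- Given a countable "bad" set `B ⊆ ℂ` and a function `g` with countable fibres off `B`, there are
`N` points outside `B` on which `g` is injective (`ℂ` is uncountable). [folklore] -/
theorem exists_finset_card_eq_injOn {B : Set ℂ} (hB : B.Countable) (g : ℂ → ℂ)
    (hg : ∀ a, {z | z ∉ B ∧ g z = a}.Countable) (N : ℕ) :
    ∃ Z : Finset ℂ, Z.card = N ∧ (∀ z ∈ Z, z ∉ B) ∧ Set.InjOn g Z := by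
  classical
  induction N with
  | zero => exact ⟨∅, rfl, by simp, by simp⟩
  | succ N ih =>
    obtain ⟨Z, hZc, hZB, hZi⟩ := ih
    have hbad : (B ∪ (↑Z : Set ℂ) ∪ ⋃ z ∈ Z, {z' | z' ∉ B ∧ g z' = g z}).Countable :=
      (hB.union Z.countable_toSet).union (Z.countable_toSet.biUnion fun z _ => hg (g z))
    obtain ⟨z₀, hz₀⟩ := (hbad.dense_compl ℂ).nonempty
    have hz₀B : z₀ ∉ B := fun h => hz₀ (Or.inl (Or.inl h))
    have hz₀Z : z₀ ∉ Z := fun h => hz₀ (Or.inl (Or.inr h))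
    have hz₀g : ∀ z ∈ Z, g z₀ ≠ g z := fun z hz h =>
      hz₀ (Or.inr (Set.mem_iUnion₂.mpr ⟨z, hz, hz₀B, h⟩))
    refine ⟨insert z₀ Z, by rw [Finset.card_insert_of_notMem hz₀Z, hZc], ?_, ?_⟩
    · intro z hz
      rcases Finset.mem_insert.mp hz with rfl | hz
      · exact hz₀B
      · exact hZB z hz
    · rw [Finset.coe_insert]
      refine (Set.injOn_insert fun h => hz₀Z h).mpr ⟨hZi, ?_⟩
      rintro ⟨z, hz, hzg⟩
      exact hz₀g z hz hzg.symm

/-! ### Generic lemma: grids avoiding countably many affine-linear constraints -/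

/-- **Grids avoiding countably many constraints.** Given, for each coordinate `i ∈ ι` (finite), a
countable set `B i ⊆ ℂ` to avoid and a function `g i` with countable fibres off `B i`, and
countably many affine-linear forms `z ↦ c_r + ∑ᵢ m_{r i} zᵢ`, there are finite sets `Z i ⊆ ℂ ∖ B i`
of any prescribed size `N`, on which the `g i` are injective, such that NO point of the grid
`∏ᵢ Z i` is sent into the countable set `Λ'` by a form with `m_r ≠ 0` (choose the `Z i` one
coordinate at a time, each time outside a countable set). [folklore] -/
theorem exists_grid_avoiding {ι ρ : Type*} [Fintype ι] [DecidableEq ι] [Countable ρ] (N : ℕ)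
    (B : ι → Set ℂ) (hB : ∀ i, (B i).Countable) (g : ι → ℂ → ℂ)
    (hg : ∀ i a, {z | z ∉ B i ∧ g i z = a}.Countable) {Λ' : Set ℂ} (hΛ : Λ'.Countable)
    (c : ρ → ℂ) (m : ρ → ι → ℂ) :
    ∃ Z : ι → Finset ℂ, (∀ i, (Z i).card = N) ∧ (∀ i, ∀ z ∈ Z i, z ∉ B i) ∧
      (∀ i, Set.InjOn (g i) (Z i)) ∧
      ∀ z : ι → ℂ, (∀ i, z i ∈ Z i) → ∀ r, m r ≠ 0 → c r + ∑ i, m r i * z i ∉ Λ' := by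
  classical
  -- induction on the set `s` of coordinates already chosen, for the forms supported in `s`
  suffices h : ∀ s : Finset ι, ∃ Z : ι → Finset ℂ,
      (∀ i ∈ s, (Z i).card = N ∧ (∀ z ∈ Z i, z ∉ B i) ∧ Set.InjOn (g i) (Z i)) ∧
      ∀ z : ι → ℂ, (∀ i ∈ s, z i ∈ Z i) → ∀ r, m r ≠ 0 → (∀ i, i ∉ s → m r i = 0) →
        c r + ∑ i, m r i * z i ∉ Λ' by
    obtain ⟨Z, hZ, hgood⟩ := h Finset.univ
    exact ⟨Z, fun i => (hZ i (Finset.mem_univ i)).1, fun i => (hZ i (Finset.mem_univ i)).2.1,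
      fun i => (hZ i (Finset.mem_univ i)).2.2,
      fun z hz r hr => hgood z (fun i _ => hz i) r hr fun i hi => absurd (Finset.mem_univ i) hi⟩
  intro s
  induction s using Finset.induction_on with
  | empty =>
    refine ⟨fun _ => ∅, fun i hi => absurd hi (Finset.notMem_empty i), ?_⟩
    intro z _ r hr h0
    exact absurd (funext fun i => h0 i (Finset.notMem_empty i)) hr
  | @insert a s ha ih =>
    obtain ⟨Z, hZ, hgood⟩ := ih
    -- the finitely many partial grid points over `s`
    let T : Finset (ι → ℂ) := Fintype.piFinset fun i => if i ∈ s then Z i else {0}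
    -- the countably many bad values of the new coordinate
    let Bad : Set ℂ := ⋃ r : ρ, ⋃ z ∈ T, ⋃ l ∈ Λ', {(l - c r - ∑ i ∈ s, m r i * z i) / m r a}
    have hBad : Bad.Countable :=
      Set.countable_iUnion fun r => T.countable_toSet.biUnion fun z _ =>
        hΛ.biUnion fun l _ => Set.countable_singleton _
    obtain ⟨Za, hZac, hZaB, hZai⟩ := exists_finset_card_eq_injOn ((hB a).union hBad) (g a)
      (fun v => (hg a v).mono fun z hz => And.intro (fun h => hz.1 (Or.inl h)) hz.2) N
    refine ⟨Function.update Z a Za, fun i hi => ?_, ?_⟩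
    · rcases Finset.mem_insert.mp hi with rfl | hi
      · simp only [Function.update_self]
        exact ⟨hZac, fun z hz h => hZaB z hz (Or.inl h), hZai⟩
      · have hia : i ≠ a := ne_of_mem_of_not_mem hi ha
        simp only [Function.update_of_ne hia]
        exact hZ i hi
    · intro z hz r hr h0
      by_cases hra : m r a = 0
      · -- the form is supported in `s`: induction hypothesis
        refine hgood z (fun i hi => ?_) r hr fun i hi => ?_
        · have hia : i ≠ a := ne_of_mem_of_not_mem hi ha
          have := hz i (Finset.mem_insert_of_mem hi)
          rwa [Function.update_of_ne hia] at this
        · by_cases hia : i = a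
          · rw [hia]; exact hra
          · exact h0 i fun h => (Finset.mem_insert.mp h).elim hia hi
      · -- the new coordinate avoids the bad value
        have hza : z a ∈ Za := by simpa using hz a (Finset.mem_insert_self a s)
        let zh : ι → ℂ := fun i => if i ∈ s then z i else 0
        have hzhT : zh ∈ T := by
          refine Fintype.mem_piFinset.mpr fun i => ?_
          by_cases hi : i ∈ s
          · have hia : i ≠ a := ne_of_mem_of_not_mem hi ha
            have := hz i (Finset.mem_insert_of_mem hi)
            rw [Function.update_of_ne hia] at this
            simp [zh, hi, this]
          · simp [zh, hi]
        have hsum : ∑ i, m r i * z i = m r a * z a + ∑ i ∈ s, m r i * zh i := by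
          rw [← Finset.add_sum_erase Finset.univ _ (Finset.mem_univ a)]
          congr 1
          symm
          refine Finset.sum_subset (fun i hi => Finset.mem_erase.mpr ⟨ne_of_mem_of_not_mem hi ha, Finset.mem_univ i⟩)
            ?_ |>.symm.trans ?_ |>.symm
          · intro i hi his
            have hia : i ≠ a := (Finset.mem_erase.mp hi).1
            rw [h0 i fun h => (Finset.mem_insert.mp h).elim hia his, zero_mul]
          · exact Finset.sum_congr rfl fun i hi => by simp [zh, hi]
        intro hmem
        have hnot : z a ∉ Bad := fun h => hZaB (z a) hza (Or.inr h)
        refine hnot (Set.mem_iUnion.mpr ⟨r, Set.mem_iUnion₂.mpr ⟨zh, hzhT, Set.mem_iUnion₂.mpr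
          ⟨_, hmem, ?_⟩⟩⟩)
        rw [Set.mem_singleton_iff, hsum, eq_div_iff hra]
        ring

/-! ### Generic lemma: the multi-indices of degree `≤ t` -/

section Count

variable (ι : Type*) [Fintype ι]

open Classical in
/-- The exponents `μ ∈ ℕ^ι` of total degree `≤ t`, as the image of the antidiagonal of level `t`
in the variables `Option ι` under "forget the extra variable". [folklore] -/
def degLE (t : ℕ) : Finset (ι →₀ ℕ) :=
  ((Finset.univ : Finset (Option ι)).finsuppAntidiag t).image Finsupp.some

variable {ι}

/-- Membership in `degLE`: total degree `≤ t`. [folklore] -/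
theorem mem_degLE_iff {t : ℕ} {μ : ι →₀ ℕ} : μ ∈ degLE ι t ↔ μ.degree ≤ t := by
  classical
  unfold degLE
  constructor
  · intro h
    obtain ⟨κ', hκ', rfl⟩ := Finset.mem_image.mp h
    rw [Finset.mem_finsuppAntidiag] at hκ'
    obtain ⟨hsum, -⟩ := hκ'
    have hs : (Finset.univ.sum fun o : Option ι => κ' o) = t := hsum
    rw [Fintype.sum_option] at hs
    rw [Finsupp.degree_eq_sum]
    simp only [Finsupp.some_apply]
    omega
  · intro h
    refine Finset.mem_image.mpr ⟨Finsupp.equivFunOnFinite.symm fun o => o.elim (t - μ.degree) μ, ?_, ?_⟩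
    · rw [Finset.mem_finsuppAntidiag]
      refine ⟨?_, by simp⟩
      show (Finset.univ.sum fun o : Option ι => (Finsupp.equivFunOnFinite.symm fun o => o.elim (t - μ.degree) μ) o) = t
      rw [Fintype.sum_option]
      simp only [Finsupp.coe_equivFunOnFinite_symm, Option.elim_none, Option.elim_some]
      have : ∑ i, μ i = μ.degree := (Finsupp.degree_eq_sum μ).symm
      omega
    · ext i
      simp

/-- **Stars and bars**: `#degLE ι t = binom(t + |ι|, |ι|)`. [folklore] -/
theorem card_degLE (t : ℕ) : (degLE ι t).card = (t + Fintype.card ι).choose (Fintype.card ι) := by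
  classical
  unfold degLE
  rw [Finset.card_image_of_injOn, Finset.card_finsuppAntidiag_nat_eq_choose, Finset.card_univ,
    Fintype.card_option, show Fintype.card ι + 1 + t - 1 = t + Fintype.card ι by omega,
    Nat.choose_symm_add]
  intro κ₁ h₁ κ₂ h₂ h
  rw [Finset.mem_coe, Finset.mem_finsuppAntidiag] at h₁ h₂
  have hs : ∀ κ' : Option ι →₀ ℕ, (Finset.univ.sum fun o : Option ι => κ' o) = t →
      κ' none + ∑ i, κ' (some i) = t := fun κ' hκ' => by rw [← hκ', Fintype.sum_option]
  have e1 := hs κ₁ h₁.1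
  have e2 := hs κ₂ h₂.1
  have htail : ∀ i, κ₁ (some i) = κ₂ (some i) := fun i => by
    have := DFunLike.congr_fun h i
    simpa using this
  ext o
  cases o with
  | none =>
    have : ∑ i, κ₁ (some i) = ∑ i, κ₂ (some i) := Finset.sum_congr rfl fun i _ => htail i
    omega
  | some i => exact htail i

end Count

/-! ### The block decomposition of the Lie algebra of `G'` -/

section Coset

variable {β γ δ : Type} [Fintype β] [Fintype γ] [Fintype δ] [DecidableEq γ]
variable (L : PeriodPair) {κM : δ → γ → Kbar}

namespace SubgroupDataC

variable (K : SubgroupDataC β γ δ κM)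

/-- The `𝔾ₘ`-block of `Lie G'`: `{y ; ∑_j q_j y_j = 0 (q ∈ A)}`. [folklore] -/
def TY : Submodule ℂ (β → ℂ) where
  carrier := {y | ∀ q ∈ K.A, ∑ j, (q j : ℂ) * y j = 0}
  zero_mem' := by simp
  add_mem' := by
    intro v w hv hw q hq
    simp only [Pi.add_apply, mul_add, Finset.sum_add_distrib, hv q hq, hw q hq, add_zero]
  smul_mem' := by
    intro a v hv q hq
    simp only [Pi.smul_apply, smul_eq_mul, mul_left_comm _ a, ← Finset.mul_sum, hv q hq, mul_zero]

/-- The `E`-block of `Lie G'`: `{z ; ∑_b c_b z_b = 0 (c ∈ C)}`. [folklore] -/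
def TZ : Submodule ℂ (γ → ℂ) where
  carrier := {z | ∀ c ∈ K.C, ∑ b, (c b : ℂ) * z b = 0}
  zero_mem' := by simp
  add_mem' := by
    intro v w hv hw c hc
    simp only [Pi.add_apply, mul_add, Finset.sum_add_distrib, hv c hc, hw c hc, add_zero]
  smul_mem' := by
    intro a v hv c hc
    simp only [Pi.smul_apply, smul_eq_mul, mul_left_comm _ a, ← Finset.mul_sum, hv c hc, mul_zero]

/-- The `𝔾ₐ`-block of `Lie G'`: `{s ; ∑_e ξ_e s_e = 0 (ξ ∈ Ξ)}`. [folklore] -/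
def TS : Submodule ℂ (δ → ℂ) where
  carrier := {s | ∀ ξ ∈ K.Ξ, ∑ e, ξ e * s e = 0}
  zero_mem' := by simp
  add_mem' := by
    intro v w hv hw ξ hξ
    simp only [Pi.add_apply, mul_add, Finset.sum_add_distrib, hv ξ hξ, hw ξ hξ, add_zero]
  smul_mem' := by
    intro a v hv ξ hξ
    simp only [Pi.smul_apply, smul_eq_mul, mul_left_comm _ a, ← Finset.mul_sum, hv ξ hξ, mul_zero]

omit [DecidableEq γ] in
/-- Membership in the `𝔾ₘ`-block. [folklore] -/
theorem mem_TY_iff (y : β → ℂ) : y ∈ K.TY ↔ ∀ q ∈ K.A, ∑ j, (q j : ℂ) * y j = 0 := Iff.rfl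

omit [DecidableEq γ] in
/-- Membership in the `E`-block. [folklore] -/
theorem mem_TZ_iff (z : γ → ℂ) : z ∈ K.TZ ↔ ∀ c ∈ K.C, ∑ b, (c b : ℂ) * z b = 0 := Iff.rfl

omit [DecidableEq γ] in
/-- Membership in the `𝔾ₐ`-block. [folklore] -/
theorem mem_TS_iff (s : δ → ℂ) : s ∈ K.TS ↔ ∀ ξ ∈ K.Ξ, ∑ e, ξ e * s e = 0 := Iff.rfl

omit [DecidableEq γ] in
/-- `Lie G'` is cut out blockwise. [folklore] -/
theorem coords_mem_tangent_iff (y : β → ℂ) (z : γ → ℂ) (s : δ → ℂ) :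
    coords y z s ∈ K.tangent ↔ y ∈ K.TY ∧ z ∈ K.TZ ∧ s ∈ K.TS := by
  rw [mem_tangent_iff]
  simp only [coords_iy, coords_iz, coords_is]
  rfl

omit [Fintype β] [Fintype γ] [Fintype δ] [DecidableEq γ] in
/-- A vector of `Lie M_κ,ℂ` is the block vector of its three blocks. [folklore] -/
theorem coords_blocks (w : β ⊕ (γ ⊕ δ) → ℂ) :
    coords (fun j => w (iy j)) (fun b => w (iz b)) (fun e => w (is e)) = w := by
  funext x
  rcases x with j | b | e <;> rfl

omit [DecidableEq γ] in
/-- **`Lie G' ≅ T_Y × T_Z × T_S`** (the equations of `Lie G'` concern the three blocks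
separately). [folklore] -/
def tangentEquiv : K.tangent ≃ₗ[ℂ] (K.TY × K.TZ × K.TS) where
  toFun w := (⟨fun j => w.1 (iy j), ((K.mem_tangent_iff _).mp w.2).1⟩,
    ⟨fun b => w.1 (iz b), ((K.mem_tangent_iff _).mp w.2).2.1⟩,
    ⟨fun e => w.1 (is e), ((K.mem_tangent_iff _).mp w.2).2.2⟩)
  invFun p := ⟨coords p.1.1 p.2.1.1 p.2.2.1, (K.coords_mem_tangent_iff _ _ _).mpr ⟨p.1.2, p.2.1.2, p.2.2.2⟩⟩
  left_inv w := by
    apply Subtype.ext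
    exact coords_blocks w.1
  right_inv p := by
    rcases p with ⟨y, z, s⟩
    rfl
  map_add' v w := rfl
  map_smul' a w := rfl

omit [DecidableEq γ] in
/-- `dim Lie G' = dim T_Y + dim T_Z + dim T_S`. [folklore] -/
theorem finrank_tangent :
    finrank ℂ K.tangent = finrank ℂ K.TY + finrank ℂ K.TZ + finrank ℂ K.TS := by
  rw [K.tangentEquiv.finrank_eq, Module.finrank_prod, Module.finrank_prod, add_assoc]

end SubgroupDataC

/-! ### Cosets `w₀ + Lie G'`: degenerate `E`-coordinates and the chart -/

variable (K : SubgroupDataC β γ δ κM) (w₀ : β ⊕ (γ ⊕ δ) → ℂ)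

/-- The **degenerate `E`-coordinates** of the coset `w₀ + Lie G'`: those `z'_b` that are constant
on it with a value in the lattice (then `σ(z'_b) ≡ 0` on the coset and the chart must use the
block `P₂ = σ³℘′`, which is `≠ 0` over the lattice). [folklore] -/
def degenerate : Set γ :=
  {b | (∀ z ∈ K.TZ, (z : γ → ℂ) b = 0) ∧ w₀ (iz b) ∈ L.lattice}

open Classical in
/-- **The chart of the coset**: block index `2` on the degenerate `E`-coordinates, `0` elsewhere.
[folklore] -/
def chart : γ → Fin 3 := fun b => if b ∈ degenerate L K w₀ then 2 else 0

omit [DecidableEq γ] in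
/-- The chart on a degenerate coordinate. [folklore] -/
theorem chart_of_degenerate {b : γ} (h : b ∈ degenerate L K w₀) : chart L K w₀ b = 2 := by
  simp [chart, h]

omit [DecidableEq γ] in
/-- The chart on a non-degenerate coordinate. [folklore] -/
theorem chart_of_not_degenerate {b : γ} (h : b ∉ degenerate L K w₀) : chart L K w₀ b = 0 := by
  simp [chart, h]

/-- **The good points** of `Lie M_κ,ℂ` for the coset: the degenerate `E`-coordinates are in the
lattice and the other ones are off it (a dense condition on the coset). [folklore] -/
def good : Set (β ⊕ (γ ⊕ δ) → ℂ) :=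
  {w' | ∀ b, (b ∈ degenerate L K w₀ → w' (iz b) ∈ L.lattice) ∧
    (b ∉ degenerate L K w₀ → w' (iz b) ∉ L.lattice)}

omit [DecidableEq γ] in
/-- At a good point every block of the chart is non-zero. [folklore] -/
theorem univExtP_chart_ne_zero {w' : β ⊕ (γ ⊕ δ) → ℂ} (hw : w' ∈ good L K w₀) (b : γ) :
    L.univExtP (chart L K w₀ b) (w' (iz b)) ≠ 0 := by
  by_cases hb : b ∈ degenerate L K w₀
  · rw [chart_of_degenerate L K w₀ hb]
    obtain ⟨m, n, h⟩ := PeriodPair.mem_lattice.mp ((hw b).1 hb)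
    obtain ⟨c, hc, -, -, h2, -⟩ := L.exists_univExtTheta_lattice m n 0
    simp only [PeriodPair.univExtTheta_inl] at h2
    rw [← h, h2]
    exact mul_ne_zero hc (by norm_num)
  · rw [chart_of_not_degenerate L K w₀ hb, (PeriodPair.univExtP_eq ((hw b).2 hb)).1]
    exact pow_ne_zero _ (L.weierstrassSigma_ne_zero ((hw b).2 hb))

/-- The base index `J* = (none, (chart, none))` of the coset: `Θ_{J*} = ∏_b P_{chart b}(z'_b)`.
[folklore] -/
def Jstar : Option β × ThetaIdx γ δ := (none, (chart L K w₀, none))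

/-- **`Θ_{J*} ≠ 0` at the good points of the coset.** [folklore] -/
theorem theta_Jstar_ne_zero {w' : β ⊕ (γ ⊕ δ) → ℂ} (hw : w' ∈ good L K w₀) :
    theta L κM (Jstar L K w₀) w' ≠ 0 := by
  simp only [Jstar, theta, thetaT_none, thetaP_none, one_mul, thetaPnone]
  exact Finset.prod_ne_zero_iff.mpr fun b _ => univExtP_chart_ne_zero L K w₀ hw b

/-! ### The coordinate functions of the coset as theta ratios -/

variable (Fy : Finset β) (Fz : Finset γ) (Fs : Finset δ)

/-- The index type of the free coordinates `F_y ⊔ F_z ⊔ F_s`. [folklore] -/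
abbrev Idx (Fy : Finset β) (Fz : Finset γ) (Fs : Finset δ) : Type := ↥Fy ⊕ (↥Fz ⊕ ↥Fs)

/-- The theta indices of the coordinate functions: `(j, (chart, none))` (`↦ e^{y'_j} Θ_{J*}`),
`(none, (chart[b ↦ 1], none))` (`↦ ℘(z'_b) Θ_{J*}`), `(none, (chart, e))` (`↦ ν_e Θ_{J*}`).
[folklore] -/
def Jmap : Idx Fy Fz Fs → Option β × ThetaIdx γ δ
  | Sum.inl j => (some j.1, (chart L K w₀, none))
  | Sum.inr (Sum.inl b) => (none, (Function.update (chart L K w₀) b.1 1, none))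
  | Sum.inr (Sum.inr e) => (none, (chart L K w₀, some e.1))

/-- **The coordinate functions** `Θ_{J(i)}/Θ_{J*}` of the coset (`e^{y'_j}`, `℘(z'_b)`,
`s_e - ∑_b κ_{eb} Z_{chart b}(z'_b)/P_{chart b}(z'_b)` at good points). [folklore] -/
def vals (w' : β ⊕ (γ ⊕ δ) → ℂ) (i : Idx Fy Fz Fs) : ℂ :=
  theta L κM (Jmap L K w₀ Fy Fz Fs i) w' / theta L κM (Jstar L K w₀) w'

/-- **Homogenisation**: the exponent of the theta monomial `∏_i X_{J(i)}^{μ_i} · X_{J*}^{t - |μ|}`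
of degree `t` attached to `μ ∈ ℕ^ι`, `|μ| ≤ t`. [folklore] -/
def expo (t : ℕ) (μ : Idx Fy Fz Fs →₀ ℕ) : (Option β × ThetaIdx γ δ) →₀ ℕ :=
  μ.mapDomain (Jmap L K w₀ Fy Fz Fs) + Finsupp.single (Jstar L K w₀) (t - μ.degree)

/-- The theta monomial attached to `μ`, `|μ| ≤ t`, is a form of degree `t`. [folklore] -/
theorem isHomogeneous_monomial_expo {t : ℕ} {μ : Idx Fy Fz Fs →₀ ℕ} (hμ : μ.degree ≤ t) :
    (monomial (expo L K w₀ Fy Fz Fs t μ) (1 : ℂ)).IsHomogeneous t := by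
  refine isHomogeneous_monomial _ ?_
  rw [expo, map_add, Finsupp.degree_mapDomain, Finsupp.degree_single]
  omega

/-- **The evaluation identity**: at a good point `w'` of the coset,
`F_{X^{expo μ}}(w') = Θ_{J*}(w')^t · ∏_i vals_i(w')^{μ_i}`. [folklore] -/
theorem thetaEval_monomial_expo {t : ℕ} {μ : Idx Fy Fz Fs →₀ ℕ} (hμ : μ.degree ≤ t)
    {w' : β ⊕ (γ ⊕ δ) → ℂ} (hw : w' ∈ good L K w₀) :
    thetaEval L κM (monomial (expo L K w₀ Fy Fz Fs t μ) 1) w' =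
      theta L κM (Jstar L K w₀) w' ^ t * ∏ i, vals L K w₀ Fy Fz Fs w' i ^ μ i := by
  have hΘ := theta_Jstar_ne_zero L K w₀ (κM := κM) hw
  set Θ := theta L κM (Jstar L K w₀) w' with hΘdef
  have h0 : ∀ J : Option β × ThetaIdx γ δ, (fun (J : Option β × ThetaIdx γ δ) (e : ℕ) => theta L κM J w' ^ e) J 0 = 1 :=
    fun J => pow_zero _
  have hadd : ∀ (J : Option β × ThetaIdx γ δ) (e₁ e₂ : ℕ),
      (fun (J : Option β × ThetaIdx γ δ) (e : ℕ) => theta L κM J w' ^ e) J (e₁ + e₂) =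
        (fun (J : Option β × ThetaIdx γ δ) (e : ℕ) => theta L κM J w' ^ e) J e₁ *
          (fun (J : Option β × ThetaIdx γ δ) (e : ℕ) => theta L κM J w' ^ e) J e₂ :=
    fun J e₁ e₂ => pow_add _ _ _
  rw [thetaEval, eval_monomial, one_mul, expo, Finsupp.prod_add_index' h0 hadd,
    Finsupp.prod_mapDomain_index h0 hadd]
  rw [Finsupp.prod_single_index (h := fun J e => theta L κM J w' ^ e) (pow_zero _),
    Finsupp.prod_fintype _ _ (fun i => pow_zero _)]
  -- `Θ_{J(i)} = vals_i · Θ_{J*}`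
  have hval : ∀ i, theta L κM (Jmap L K w₀ Fy Fz Fs i) w' = vals L K w₀ Fy Fz Fs w' i * Θ := fun i => by
    rw [vals, div_mul_cancel₀ _ hΘ]
  simp only [hval, mul_pow, Finset.prod_mul_distrib, Finset.prod_pow_eq_pow_sum]
  rw [← hΘdef, ← Finsupp.degree_eq_sum]
  have key : Θ ^ (t - μ.degree) * Θ ^ μ.degree = Θ ^ t := by
    rw [← pow_add, Nat.sub_add_cancel hμ]
  linear_combination (∏ x, vals L K w₀ Fy Fz Fs w' x ^ μ x) * key

/-! ### Free coordinates: reconstruction of a block from its free coordinates -/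

section Free

variable {K}

/-- The free coordinates of `e⁻¹ x` are `x`. [folklore] -/
theorem coe_symm_apply {ι' : Type*} [Fintype ι'] {V : Submodule ℂ (ι' → ℂ)} {F : Finset ι'}
    (e : V ≃ₗ[ℂ] (F → ℂ)) (he : ∀ v i, e v i = (v : ι' → ℂ) i) (x : F → ℂ) (i : F) :
    ((e.symm x : V) : ι' → ℂ) i = x i := by
  have := he (e.symm x) i
  rw [LinearEquiv.apply_symm_apply] at this
  exact this.symm

/-- **Reconstruction matrix**: every coordinate of `e⁻¹ x` is the linear combination
`∑_i m_{r i} x_i` with `m_{r i} = (e⁻¹ δ_i)_r`. [folklore] -/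
theorem coe_symm_eq_sum {ι' : Type*} [Fintype ι'] {V : Submodule ℂ (ι' → ℂ)} {F : Finset ι'}
    [DecidableEq ↥F] (e : V ≃ₗ[ℂ] (F → ℂ)) (x : F → ℂ) (r : ι') :
    ((e.symm x : V) : ι' → ℂ) r =
      ∑ i, ((e.symm (Pi.single i 1) : V) : ι' → ℂ) r * x i := by
  conv_lhs => rw [pi_eq_sum_univ' x]
  simp only [map_sum, map_smul, Submodule.coe_sum, Submodule.coe_smul, Finset.sum_apply,
    Pi.smul_apply, smul_eq_mul]
  exact Finset.sum_congr rfl fun i _ => mul_comm _ _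

/-- If the `r`-th row of the reconstruction matrix vanishes, the `r`-th coordinate vanishes on
`V`. [folklore] -/
theorem apply_eq_zero_of_row_eq_zero {ι' : Type*} [Fintype ι'] {V : Submodule ℂ (ι' → ℂ)}
    {F : Finset ι'} [DecidableEq ↥F] (e : V ≃ₗ[ℂ] (F → ℂ)) {r : ι'}
    (h : ∀ i, ((e.symm (Pi.single i 1) : V) : ι' → ℂ) r = 0) (v : V) : (v : ι' → ℂ) r = 0 := by
  have := coe_symm_eq_sum e (e v) r
  rw [LinearEquiv.symm_apply_apply] at this
  rw [this]
  exact Finset.sum_eq_zero fun i _ => by rw [h i, zero_mul]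

end Free

/-! ### Realising prescribed values at good points of the coset -/

/-- The values `1, 2, …, t + 1` (non-zero, `t + 1` of them). [folklore] -/
def valSet (t : ℕ) : Finset ℂ := (Finset.range (t + 1)).image fun k : ℕ => (k : ℂ) + 1

omit [Fintype β] [Fintype γ] [Fintype δ] [DecidableEq γ] in
/-- `#valSet t = t + 1`. [folklore] -/
theorem card_valSet (t : ℕ) : (valSet t).card = t + 1 := by
  rw [valSet, Finset.card_image_of_injective _ fun a b h => by exact_mod_cast add_right_cancel h,
    Finset.card_range]

omit [Fintype β] [Fintype γ] [Fintype δ] [DecidableEq γ] in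
/-- The members of `valSet t` are non-zero. [folklore] -/
theorem ne_zero_of_mem_valSet {t : ℕ} {x : ℂ} (hx : x ∈ valSet t) : x ≠ 0 := by
  obtain ⟨k, -, rfl⟩ := Finset.mem_image.mp hx
  exact_mod_cast Nat.succ_ne_zero k

/-- **Realisation.** Given free coordinates of the three blocks of `Lie G'` (linear isomorphisms
`T_Y ≅ ℂ^{F_y}`, `T_Z ≅ ℂ^{F_z}`, `T_S ≅ ℂ^{F_s}` by restriction of coordinates) and finite sets
`Zg b ⊆ ℂ` (`b ∈ F_z`) of values of the free `E`-coordinates such that on the grid `∏ Zg b` every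
non-constant `E`-coordinate of the coset stays off the lattice, every value vector `a` with
`a_j ≠ 0` (`j ∈ F_y`) and `a_b ∈ ℘(w₀,b + Zg b)` (`b ∈ F_z`) is the vector of coordinate functions
`vals` at a good point of the coset `w₀ + Lie G'`. [folklore] -/
theorem exists_good_vals_eq (ey : K.TY ≃ₗ[ℂ] (Fy → ℂ)) (hey : ∀ v j, ey v j = (v : β → ℂ) j)
    (ez : K.TZ ≃ₗ[ℂ] (Fz → ℂ)) (hez : ∀ v b, ez v b = (v : γ → ℂ) b)
    (es : K.TS ≃ₗ[ℂ] (Fs → ℂ)) (hes : ∀ v e, es v e = (v : δ → ℂ) e)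
    (Zg : Fz → Finset ℂ)
    (hZgood : ∀ x : Fz → ℂ, (∀ b, x b ∈ Zg b) → ∀ r : γ,
      (fun b => ((ez.symm (Pi.single b 1) : K.TZ) : γ → ℂ) r) ≠ 0 →
        w₀ (iz r) + ∑ b, ((ez.symm (Pi.single b 1) : K.TZ) : γ → ℂ) r * x b ∉ L.lattice)
    (a : Idx Fy Fz Fs → ℂ) (hay : ∀ j, a (Sum.inl j) ≠ 0)
    (haz : ∀ b, ∃ x ∈ Zg b, ℘[L] (w₀ (iz b) + x) = a (Sum.inr (Sum.inl b))) :
    ∃ w ∈ K.tangent, w₀ + w ∈ good L K w₀ ∧ vals L K w₀ Fy Fz Fs (κM := κM) (w₀ + w) = a := by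
  classical
  choose x hxZ hxa using haz
  -- the three blocks
  let y : K.TY := ey.symm fun j => Complex.log (a (Sum.inl j)) - w₀ (iy j)
  let z : K.TZ := ez.symm x
  let zf : γ → ℂ := fun r => w₀ (iz r) + (z : γ → ℂ) r
  let φ : δ → ℂ := fun e => ∑ r, (κM e r : ℂ) *
    (L.univExtZ (chart L K w₀ r) (zf r) / L.univExtP (chart L K w₀ r) (zf r))
  let sv : K.TS := es.symm fun e => a (Sum.inr (Sum.inr e)) + φ e - w₀ (is e)
  let w : β ⊕ (γ ⊕ δ) → ℂ := coords (y : β → ℂ) (z : γ → ℂ) (sv : δ → ℂ)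
  have hw : w ∈ K.tangent := (K.coords_mem_tangent_iff _ _ _).mpr ⟨y.2, z.2, sv.2⟩
  have hwy : ∀ j, (w₀ + w) (iy j) = w₀ (iy j) + (y : β → ℂ) j := fun j => rfl
  have hwz : ∀ r, (w₀ + w) (iz r) = zf r := fun r => rfl
  have hws : ∀ e, (w₀ + w) (is e) = w₀ (is e) + (sv : δ → ℂ) e := fun e => rfl
  -- the free coordinates of the blocks
  have hyF : ∀ j : Fy, (y : β → ℂ) j = Complex.log (a (Sum.inl j)) - w₀ (iy j) := fun j =>
    coe_symm_apply ey hey _ j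
  have hzF : ∀ b : Fz, (z : γ → ℂ) b = x b := fun b => coe_symm_apply ez hez _ b
  have hsF : ∀ e : Fs, (sv : δ → ℂ) e = a (Sum.inr (Sum.inr e)) + φ e - w₀ (is e) := fun e =>
    coe_symm_apply es hes _ e
  -- free `E`-coordinates are not degenerate
  have hndeg : ∀ b : Fz, (b : γ) ∉ degenerate L K w₀ := fun b hb => by
    have h1 := hb.1 _ (ez.symm (Pi.single b 1)).2
    rw [coe_symm_apply ez hez] at h1
    simp at h1
  -- the point is good
  have hgood : w₀ + w ∈ good L K w₀ := by
    intro r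
    constructor
    · intro hr
      rw [hwz]
      show w₀ (iz r) + (z : γ → ℂ) r ∈ L.lattice
      rw [hr.1 _ z.2, add_zero]
      exact hr.2
    · intro hr
      rw [hwz]
      show w₀ (iz r) + (z : γ → ℂ) r ∉ L.lattice
      by_cases hrow : (fun b => ((ez.symm (Pi.single b 1) : K.TZ) : γ → ℂ) r) = 0
      · have hrow' : ∀ b, ((ez.symm (Pi.single b 1) : K.TZ) : γ → ℂ) r = 0 := fun b =>
          congr_fun hrow b
        have hzr : ∀ v : K.TZ, (v : γ → ℂ) r = 0 := apply_eq_zero_of_row_eq_zero ez hrow'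
        rw [hzr z, add_zero]
        intro hmem
        exact hr ⟨fun v hv => hzr ⟨v, hv⟩, hmem⟩
      · have := hZgood x hxZ r hrow
        rwa [← coe_symm_eq_sum ez x r] at this
  refine ⟨w, hw, hgood, ?_⟩
  -- the values
  have hP : ∀ r, L.univExtP (chart L K w₀ r) (zf r) ≠ 0 := fun r => by
    rw [← hwz]; exact univExtP_chart_ne_zero L K w₀ hgood r
  have hPi : thetaPnone (β := β) (δ := δ) L (chart L K w₀) (w₀ + w) ≠ 0 :=
    Finset.prod_ne_zero_iff.mpr fun r _ => hP r
  funext i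
  rcases i with j | b | e
  · -- `e^{y'_j}`
    simp only [vals, Jmap, Jstar, theta, thetaT_some, thetaT_none, thetaP_none, one_mul]
    rw [mul_div_assoc, div_self hPi, mul_one, hwy, hyF, add_sub_cancel, Complex.exp_log (hay j)]
  · -- `℘(z'_b)`
    have hb0 : chart L K w₀ b = 0 := chart_of_not_degenerate L K w₀ (hndeg b)
    have hbΛ : zf b ∉ L.lattice := by rw [← hwz]; exact (hgood b).2 (hndeg b)
    simp only [vals, Jmap, Jstar, theta, thetaT_none, thetaP_none, one_mul, thetaPnone]
    have hupd : ∀ r, L.univExtP (Function.update (chart L K w₀) b 1 r) ((w₀ + w) (iz r)) =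
        Function.update (fun r => L.univExtP (chart L K w₀ r) ((w₀ + w) (iz r))) (b : γ)
          (L.univExtP 1 ((w₀ + w) (iz b))) r := fun r => by
      by_cases hrb : r = b
      · subst hrb; simp
      · simp [Function.update_of_ne hrb]
    rw [Finset.prod_congr rfl fun r _ => hupd r, Finset.prod_update_of_mem (Finset.mem_univ _),
      Finset.prod_eq_mul_prod_sdiff_singleton_of_mem (Finset.mem_univ (b : γ))
        (fun r => L.univExtP (chart L K w₀ r) ((w₀ + w) (iz r))),
      mul_div_mul_right _ _ (Finset.prod_ne_zero_iff.mpr fun r _ => by rw [hwz]; exact hP r),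
      hb0, hwz, (PeriodPair.univExtP_eq hbΛ).1, (PeriodPair.univExtP_eq hbΛ).2.1,
      mul_div_cancel_left₀ _ (pow_ne_zero _ (L.weierstrassSigma_ne_zero hbΛ))]
    show ℘[L] (w₀ (iz b) + (z : γ → ℂ) b) = a (Sum.inr (Sum.inl b))
    rw [hzF, hxa]
  · -- `ν_e` in the chart
    simp only [vals, Jmap, Jstar, theta, thetaT_none, thetaP_none, thetaP_some, one_mul, thetaPsome]
    rw [sub_div, mul_div_assoc, div_self hPi, mul_one, Finset.sum_div]
    have hterm : ∀ r, (κM e r : ℂ) * (L.univExtZ (chart L K w₀ r) ((w₀ + w) (iz r)) *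
        ∏ r' ∈ Finset.univ.erase r, L.univExtP (chart L K w₀ r') ((w₀ + w) (iz r'))) /
          thetaPnone (β := β) (δ := δ) L (chart L K w₀) (w₀ + w) =
        (κM e r : ℂ) * (L.univExtZ (chart L K w₀ r) (zf r) / L.univExtP (chart L K w₀ r) (zf r)) := by
      intro r
      rw [thetaPnone, ← Finset.mul_prod_erase Finset.univ _ (Finset.mem_univ r), mul_div_assoc,
        mul_div_mul_right _ _ (Finset.prod_ne_zero_iff.mpr fun r' _ => by rw [hwz]; exact hP r'), hwz]
    rw [Finset.sum_congr rfl fun r _ => hterm r, hws, hsF]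
    ring


/-! ### Linear independence from a grid of good points -/

/-- **Independence from a grid.** If every point of a grid `∏_i A_i` with `#A_i = t + 1` is the
value vector `vals` of a good point of the coset, then the pull-backs to `Lie G'` of the theta
monomials `X^{expo μ}`, `|μ| ≤ t`, are linearly independent: a relation gives a polynomial of
partial degrees `≤ t` in the free coordinates vanishing on the grid, hence zero by the
Combinatorial Nullstellensatz (`MvPolynomial.eq_zero_of_eval_zero_at_prod_finset`). [folklore] -/
theorem linearIndependent_thetaEval_of_grid {t : ℕ} (A : Idx Fy Fz Fs → Finset ℂ)
    (hAcard : ∀ i, (A i).card = t + 1)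
    (hreal : ∀ a : Idx Fy Fz Fs → ℂ, (∀ i, a i ∈ A i) →
      ∃ w ∈ K.tangent, w₀ + w ∈ good L K w₀ ∧ vals L K w₀ Fy Fz Fs (κM := κM) (w₀ + w) = a) :
    LinearIndependent ℂ fun μ : ↥(degLE (Idx Fy Fz Fs) t) => fun w : K.tangent =>
      thetaEval L κM (monomial (expo L K w₀ Fy Fz Fs t μ.1) (1 : ℂ)) (w₀ + w) := by
  classical
  rw [Fintype.linearIndependent_iff]
  intro c hc μ₀
  -- the polynomial `R = ∑ c_μ X^μ` in the free coordinates vanishes on the grid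
  set R : MvPolynomial (Idx Fy Fz Fs) ℂ := ∑ μ : ↥(degLE (Idx Fy Fz Fs) t), monomial μ.1 (c μ)
    with hRdef
  have hReval : ∀ a : Idx Fy Fz Fs → ℂ, (∀ i, a i ∈ A i) → eval a R = 0 := by
    intro a ha
    obtain ⟨w, hw, hgood, hvals⟩ := hreal a ha
    have h1 := congr_fun hc ⟨w, hw⟩
    simp only [Finset.sum_apply, Pi.smul_apply, smul_eq_mul, Pi.zero_apply] at h1
    have h2 : ∀ μ : ↥(degLE (Idx Fy Fz Fs) t),
        thetaEval L κM (monomial (expo L K w₀ Fy Fz Fs t μ.1) (1 : ℂ)) (w₀ + w) =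
          theta L κM (Jstar L K w₀) (w₀ + w) ^ t * ∏ i, a i ^ (μ.1 : Idx Fy Fz Fs →₀ ℕ) i := by
      intro μ
      rw [thetaEval_monomial_expo L K w₀ Fy Fz Fs (mem_degLE_iff.mp μ.2) hgood, hvals]
    have h1' : theta L κM (Jstar L K w₀) (w₀ + w) ^ t *
        ∑ μ : ↥(degLE (Idx Fy Fz Fs) t), c μ * ∏ i, a i ^ (μ.1 : Idx Fy Fz Fs →₀ ℕ) i = 0 := by
      rw [← h1, Finset.mul_sum]
      refine Finset.sum_congr rfl fun μ _ => ?_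
      rw [h2 μ]
      ring
    have h3 : ∑ μ : ↥(degLE (Idx Fy Fz Fs) t), c μ * ∏ i, a i ^ (μ.1 : Idx Fy Fz Fs →₀ ℕ) i = 0 :=
      (mul_eq_zero.mp h1').resolve_left (pow_ne_zero _ (theta_Jstar_ne_zero L K w₀ hgood))
    rw [← h3, hRdef, map_sum]
    refine Finset.sum_congr rfl fun μ _ => ?_
    rw [eval_monomial, Finsupp.prod_fintype _ _ fun i => pow_zero _]
  -- hence `R = 0` (Alon's Nullstellensatz: all partial degrees are `≤ t < t + 1`)
  have hRdeg : R.totalDegree ≤ t := by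
    refine (totalDegree_finsetSum _ _).trans (Finset.sup_le fun μ _ => ?_)
    refine (totalDegree_monomial_le _ _).trans ?_
    have := mem_degLE_iff.mp μ.2
    rw [Finsupp.degree_eq_sum] at this
    rw [Finsupp.sum_fintype _ _ (fun _ => rfl)]
    simpa using this
  have hR : R = 0 :=
    eq_zero_of_eval_zero_at_prod_finset R A
      (fun i => by rw [hAcard]; exact Nat.lt_succ_of_le ((degreeOf_le_totalDegree R i).trans hRdeg))
      hReval
  -- and `c_{μ₀}` is a coefficient of `R`
  have hcoeff : coeff μ₀.1 R = c μ₀ := by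
    rw [hRdef, coeff_sum]
    simp only [coeff_monomial]
    rw [Finset.sum_eq_single μ₀ (fun μ _ hne => if_neg fun h => hne (Subtype.ext h))
      (fun h => absurd (Finset.mem_univ μ₀) h)]
    simp
  rw [← hcoeff, hR, coeff_zero]

/-- The value grid: `1, …, t + 1` for the torus and fibre coordinates, `℘(w₀,b + Zg b)` for the free
`E`-coordinates. [folklore] -/
def gridSets (t : ℕ) (Zg : ↥Fz → Finset ℂ) : Idx Fy Fz Fs → Finset ℂ
  | Sum.inl _ => valSet t
  | Sum.inr (Sum.inl b) => (Zg b).image fun x => ℘[L] (w₀ (iz b) + x)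
  | Sum.inr (Sum.inr _) => valSet t

/-! ### The theorem -/

/-- **Lower bound for the Hilbert function of a coset of an algebraic subgroup (theta model).**
For a connected algebraic subgroup `G'` of `M_κ,ℂ` (`K : SubgroupDataC`, `Lie G' = K.tangent`,
`m = dim Lie G'`), a point `w₀ ∈ Lie M_κ,ℂ` and a degree `t`, there are `binom(t + m, m)` forms
`P_k` of degree `t` in the theta functions whose pull-backs `F_{P_k}(w₀ + ·) = P_k(Θ(w₀ + ·))`
to `Lie G'` are `ℂ`-linearly independent. Equivalently, the ideal `𝔭 = 𝔍(w₀ + G')` of the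
translate `exp(w₀) + G' ⊂ M_κ ⊂ ℙ^N` satisfies `H(𝔭; t) ≥ binom(t + m, m) ≥ t^m / m!` for all
`t` — the lower bound `ℋ(H₀; D) ≥ D^{dim H₀}` (`deg H₀ ≥ 1`) for the translates `σ + H₀` on the
left-hand side of Philippon's zero estimate (Roy's Prop. 2.3 and Thm. 4.1; for `𝔾ₐ × 𝔾ₘⁿ` the
tree's `GaGmSubgroupDegrees.lean`), here for the theta model of `M_κ` and uniformly in `G'` and
`w₀`. [cite: NesterenkoPhilippon2001, Ch. 11 Prop. 2.3, Thm. 4.1 (ℋ(H₀; D) ≥ D^{n-δ}, p. 221)] -/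
theorem exists_linearIndependent_thetaEval_coset (K : SubgroupDataC β γ δ κM)
    (w₀ : β ⊕ (γ ⊕ δ) → ℂ) (t : ℕ) :
    ∃ (n : ℕ) (P : Fin n → MvPolynomial (Option β × ThetaIdx γ δ) ℂ),
      n = (t + finrank ℂ K.tangent).choose (finrank ℂ K.tangent) ∧
      (∀ k, (P k).IsHomogeneous t) ∧
      LinearIndependent ℂ fun k => fun w : K.tangent => thetaEval L κM (P k) (w₀ + w) := by
  classical
  -- free coordinates of the three blocks
  obtain ⟨Fy, hFy, hby⟩ := K.TY.exists_finset_restrict_bijective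
  obtain ⟨Fz, hFz, hbz⟩ := K.TZ.exists_finset_restrict_bijective
  obtain ⟨Fs, hFs, hbs⟩ := K.TS.exists_finset_restrict_bijective
  let fy : K.TY →ₗ[ℂ] (Fy → ℂ) := LinearMap.pi fun j : Fy => (LinearMap.proj (j : β)).comp K.TY.subtype
  let fz : K.TZ →ₗ[ℂ] (Fz → ℂ) := LinearMap.pi fun b : Fz => (LinearMap.proj (b : γ)).comp K.TZ.subtype
  let fs : K.TS →ₗ[ℂ] (Fs → ℂ) := LinearMap.pi fun e : Fs => (LinearMap.proj (e : δ)).comp K.TS.subtype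
  let ey : K.TY ≃ₗ[ℂ] (Fy → ℂ) := LinearEquiv.ofBijective fy hby
  let ez : K.TZ ≃ₗ[ℂ] (Fz → ℂ) := LinearEquiv.ofBijective fz hbz
  let es : K.TS ≃ₗ[ℂ] (Fs → ℂ) := LinearEquiv.ofBijective fs hbs
  have hey : ∀ v j, ey v j = (v : β → ℂ) j := fun _ _ => rfl
  have hez : ∀ v b, ez v b = (v : γ → ℂ) b := fun _ _ => rfl
  have hes : ∀ v e, es v e = (v : δ → ℂ) e := fun _ _ => rfl
  -- the count
  have hcard : Fintype.card (Idx Fy Fz Fs) = finrank ℂ K.tangent := by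
    rw [Fintype.card_sum, Fintype.card_sum, Fintype.card_coe, Fintype.card_coe, Fintype.card_coe,
      hFy, hFz, hFs, K.finrank_tangent, add_assoc]
  -- the grid of values of the free `E`-coordinates
  obtain ⟨Zg, hZgc, -, hZgi, hZgood⟩ := exists_grid_avoiding (ρ := γ) (t + 1)
    (fun b : Fz => {x : ℂ | w₀ (iz b) + x ∈ L.lattice})
    (fun b => (countable_lattice L).preimage (add_right_injective (w₀ (iz (b : γ)))))
    (fun (b : Fz) (x : ℂ) => ℘[L] (w₀ (iz b) + x))
    (fun b v => ((countable_fibre_weierstrassP L v).preimage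
      (add_right_injective (w₀ (iz (b : γ))))).mono fun x hx => And.intro hx.1 hx.2)
    (countable_lattice L) (fun r => w₀ (iz r))
    (fun r b => ((ez.symm (Pi.single b 1) : K.TZ) : γ → ℂ) r)
  -- every grid point is realised at a good point of the coset
  have hAcard : ∀ i, (gridSets L w₀ Fy Fz Fs t Zg i).card = t + 1 := by
    rintro (j | b | e)
    · exact card_valSet t
    · show ((Zg b).image fun x => ℘[L] (w₀ (iz b) + x)).card = t + 1
      rw [Finset.card_image_of_injOn (hZgi b), hZgc]
    · exact card_valSet t
  have hreal : ∀ a : Idx Fy Fz Fs → ℂ, (∀ i, a i ∈ gridSets L w₀ Fy Fz Fs t Zg i) →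
      ∃ w ∈ K.tangent, w₀ + w ∈ good L K w₀ ∧ vals L K w₀ Fy Fz Fs (κM := κM) (w₀ + w) = a := by
    intro a ha
    refine exists_good_vals_eq L K w₀ Fy Fz Fs ey hey ez hez es hes Zg hZgood a
      (fun j => ne_zero_of_mem_valSet (ha (Sum.inl j))) fun b => Finset.mem_image.mp (ha (Sum.inr (Sum.inl b)))
  have hli := linearIndependent_thetaEval_of_grid L K w₀ Fy Fz Fs (κM := κM) _ hAcard hreal
  -- reindex by `Fin n`
  refine ⟨(degLE (Idx Fy Fz Fs) t).card,
    fun k => monomial (expo L K w₀ Fy Fz Fs t ((degLE (Idx Fy Fz Fs) t).equivFin.symm k).1) 1,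
    ?_, fun k => isHomogeneous_monomial_expo L K w₀ Fy Fz Fs (mem_degLE_iff.mp (Subtype.prop _)), ?_⟩
  · rw [card_degLE, hcard]
  · exact hli.comp _ (degLE (Idx Fy Fz Fs) t).equivFin.symm.injective

/-! ### Corollaries: dimensions -/

/-- **Restriction–translation to the coset**: `F ↦ (w ↦ F(w₀ + w))` on `Lie G'`. [folklore] -/
def cosetRes (K : SubgroupDataC β γ δ κM) (w₀ : β ⊕ (γ ⊕ δ) → ℂ) :
    ((β ⊕ (γ ⊕ δ) → ℂ) → ℂ) →ₗ[ℂ] (K.tangent → ℂ) where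
  toFun F := fun w => F (w₀ + w)
  map_add' _ _ := rfl
  map_smul' _ _ := rfl

/-- **The space `ℂ[X]_t / 𝔭_t` of the coset**, `𝔭 = 𝔍(w₀ + G')`: the restrictions to
`w₀ + Lie G'` of the theta polynomials `F_P`, `P` a form of degree `t`; its dimension is the value
`H(𝔭; t)` of the Hilbert function of the ideal of the translate `exp(w₀) + G' ⊂ M_κ ⊂ ℙ^N`.
[cite: NesterenkoPhilippon2001, Ch. 11 §2.2 (H(I; D)), Prop. 2.3] -/
def cosetSpace (K : SubgroupDataC β γ δ κM) (w₀ : β ⊕ (γ ⊕ δ) → ℂ) (t : ℕ) :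
    Submodule ℂ (K.tangent → ℂ) :=
  (thetaSpace L κM t).map (cosetRes K w₀)

/-- `cosetSpace` is finite-dimensional. [folklore] -/
instance finite_cosetSpace (K : SubgroupDataC β γ δ κM) (w₀ : β ⊕ (γ ⊕ δ) → ℂ) (t : ℕ) :
    Module.Finite ℂ ↥(cosetSpace L K w₀ t (κM := κM)) :=
  Module.Finite.map _ _

/-- **`H(𝔍(w₀ + G'); t) ≥ binom(t + dim G', dim G')`** for every connected algebraic subgroup
`G'` of `M_κ,ℂ`, every `w₀` and every `t`. [cite: NesterenkoPhilippon2001, Ch. 11 Prop. 2.3, Thm. 4.1 (ℋ(H₀; D) ≥ D^{n-δ})] -/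
theorem choose_le_finrank_cosetSpace (K : SubgroupDataC β γ δ κM) (w₀ : β ⊕ (γ ⊕ δ) → ℂ) (t : ℕ) :
    (t + finrank ℂ K.tangent).choose (finrank ℂ K.tangent) ≤
      finrank ℂ ↥(cosetSpace L K w₀ t (κM := κM)) := by
  obtain ⟨n, P, hn, hP, hli⟩ := exists_linearIndependent_thetaEval_coset L K w₀ t (κM := κM)
  have hmem : ∀ k, (fun w : K.tangent => thetaEval L κM (P k) (w₀ + w)) ∈ cosetSpace L K w₀ t (κM := κM) :=
    fun k => Submodule.mem_map_of_mem
      (Submodule.mem_map.mpr ⟨P k, (mem_homogeneousSubmodule t (P k)).mpr (hP k), rfl⟩)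
  have hli' : LinearIndependent ℂ fun k =>
      (⟨fun w : K.tangent => thetaEval L κM (P k) (w₀ + w), hmem k⟩ : ↥(cosetSpace L K w₀ t (κM := κM))) :=
    LinearIndependent.of_comp (cosetSpace L K w₀ t (κM := κM)).subtype hli
  have := hli'.fintype_card_le_finrank
  rwa [Fintype.card_fin, hn] at this

/-- **`H(M_κ; t) ≥ binom(t + n, n)`**, `n = dim M_κ`: the lower bound complementing
`finrank_thetaSpace_le` (`PkappaThetaHilbert.lean`). [cite: NesterenkoPhilippon2001, Ch. 11 §2.2 (i) (ℋ((0); D) = Dⁿ)] -/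
theorem choose_le_finrank_thetaSpace (t : ℕ) :
    (t + Fintype.card (β ⊕ (γ ⊕ δ))).choose (Fintype.card (β ⊕ (γ ⊕ δ))) ≤
      finrank ℂ ↥(thetaSpace (β := β) L κM t) := by
  have htop : finrank ℂ (SubgroupDataC.top κM : SubgroupDataC β γ δ κM).tangent =
      Fintype.card (β ⊕ (γ ⊕ δ)) := by
    rw [SubgroupDataC.tangent_top, finrank_top, Module.finrank_fintype_fun_eq_card]
  obtain ⟨n, P, hn, hP, hli⟩ :=
    exists_linearIndependent_thetaEval_coset L (SubgroupDataC.top κM : SubgroupDataC β γ δ κM) 0 t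
  rw [htop] at hn
  -- the unrestricted functions are linearly independent, and lie in `thetaSpace t`
  have hli₀ : LinearIndependent ℂ fun k => thetaEval L κM (P k) :=
    LinearIndependent.of_comp (cosetRes (SubgroupDataC.top κM : SubgroupDataC β γ δ κM) 0) hli
  have hmem : ∀ k, thetaEval L κM (P k) ∈ thetaSpace (β := β) L κM t := fun k =>
    Submodule.mem_map.mpr ⟨P k, (mem_homogeneousSubmodule t (P k)).mpr (hP k), rfl⟩
  have hli' : LinearIndependent ℂ fun k => (⟨thetaEval L κM (P k), hmem k⟩ : ↥(thetaSpace (β := β) L κM t)) :=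
    LinearIndependent.of_comp (thetaSpace (β := β) L κM t).subtype hli₀
  have := hli'.fintype_card_le_finrank
  rwa [Fintype.card_fin, hn] at this

end Coset

end Std

end GaGmE

end Literature.NumberTheory.Transcendental

end
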